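import Summits.BirchSwinnertonDyer.Rank1Residual.P2.KrizLiTwoFortyThreeIsogenyClass
import Summits.BirchSwinnertonDyer.Rank1Residual.WAll.TargetCMTwoInertShuZhaiThirtySix
import HarnessLib
import HarnessLib.Audit.Tags

/-!
# Rung W-ALL of ladder BSD (D-0120) — the INERT slices of row 12₂ (`WAllCornerFTwoInertGood ∧
# WAllCornerFTwoInertBad`: CM, `ord_{s=1} L(E,s) = 1`, `2` inert in the CM field) cut a SECOND time,
# flag-free: ON the `ℚ`-isogeny classes of the Kriz–Li 2019 twists of `243a1` (cell `bsd-print-cf2`,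
# seat p3; after the Shu–Zhai `36a1` cut of `WAll/TargetCMTwoInertShuZhaiThirtySix.lean`)

HONEST FRAMING (cell `bsd-print-cf2`, run/shared/lean/pub/bsd-print-cf2/): STATEMENTS AND BOOKKEEPING
ONLY in §1–§2 — nothing asserted, nothing booked, no named fact, no published theorem restated; the two
`@[conjecture] def`s below are an OPEN obligation and a SLICE of the registered leaf
`Summit.BirchSwinnertonDyer.WAllCornerFTwo` (via seat p4's `WAll/TargetCMTwoSlices.lean`, p532371, and the
first p3 cut `WAll/TargetCMTwoInertShuZhaiThirtySix.lean`, p540044), cut by ONE more decidable-in-principle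
predicate: `P2.IsIsogenousToKrizLiTwoFortyThreeTwist W` ("`W` is `ℚ`-isogenous to `243a1^{(d)}` or to
`243a1^{(−23d)}` for some `d ∈ 𝒩` — Kriz–Li Def 4.1 at `(243a1, ℚ(√−23))` — with `χ_d(−N) = 1`",
`P2/KrizLiTwoFortyThreeIsogenyClass.lean`). §3 is the CLOSER of the new ON-leaf granted eight named facts
BY NAME (`P2.cornerFTwo_krizLiTwoFortyThree_isogenyClass_byName`: Kriz–Li 2019 Thm 5.1 (2) and Thm 4.3,
the Kriz–Li Table-1 row `243a1`, Creutz–Miller 2012 Thm 1.1, Burungale–Flach 2024 (row C8), modularity,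
GZK, Cassels) — every one a cite-tagged statement-only `Prop` of the tree; five of them conjuncts of the
crux bundle 𝔅_inert of route PrintCf2. Beyond print: YES as an assembly of printed theorems (the
rank-zero base `BSD(243a1^{(−23)}, 2)` is Burungale–Flach 2024 where Kriz–Li say "numerical
verification"), NO as a method. The new OFF-leaf (off BOTH explicit families) is the named residual of the
p3 road inside the inert slices: every cube-sum curve `x³ + y³ = n` off the class of `9` (the K7t leaf
`X12.CMAtTwo` = 𝒞_HSY among them), every other `j ∈ {0, 54000, −12288000}` curve of analytic rank one,
and the five odd Heegner fields — no theorem in print.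

| slice `Prop` | shape (all `∀ W [..] [..], W.HasCM → W.analyticRank = 1 → CMInert W 2 → …`) | status |
|---|---|---|
| `WAllCornerFTwoInertShuZhaiThirtySix` (p540044) | `… → P2.IsIsogenousToShuZhaiThirtySixTwist W → BSDp W 2` | CLOSED granted facts |
| `WAllCornerFTwoInertKrizLiTwoFortyThree` (here) | `… → P2.IsIsogenousToKrizLiTwoFortyThreeTwist W → BSDp W 2` | CLOSED granted facts (§3) |
| `WAllCornerFTwoInertOffShuZhaiOffKrizLi` (here) | `… → ¬ SZ36-class → ¬ KL243-class → BSDp W 2` | OPEN (the residual) |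

§2 glue (excluded middle only): `(InertGood ∧ InertBad) ⟺ (SZ36 ∧ KL243 ∧ OFF-both)` EXACT; the former
residual `WAllCornerFTwoInertOffShuZhaiThirtySix ⟹ OFF-both`, and `⟸` given the KL243 leaf.

References: `WAll/TargetCMTwoSlices.lean` (p4), `WAll/TargetCMTwoInertShuZhaiThirtySix.lean` (p3),
`P2/KrizLiTwoFortyThree{Curve,Slices,IsogenyClass}.lean` (p3), route file `Theses/PrintCf2.lean` item
20363; [cite: KrizLi2019, Thm. 5.1 (2), Thm. 4.3, §6 Table 1 row 243a1]; [cite: Miller2011LMS, Def. 1.1].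
-/

noncomputable section

open scoped Classical

open WeierstrassCurve Literature.NumberTheory.EllipticCurves
  Literature.NumberTheory.EllipticCurves.Rank1Residual Literature.NumberTheory.EllipticCurves.ModularForms
  Literature.NumberTheory.EllipticCurves.ShuZhai2021 Literature.NumberTheory.EllipticCurves.KrizLi2019
open Summit.BirchSwinnertonDyer.Rank1Residual

set_option autoImplicit false

namespace Summit.BirchSwinnertonDyer

/-! ### §1. The inert slices cut along the Kriz–Li `243a1` isogeny classes -/

/-- **Inert slices ON THE KRIZ–LI `243a1` ISOGENY CLASSES** (closed granted named facts by
`wAllCornerFTwoInertKrizLiTwoFortyThree_of_facts`, §3): CM, `ord_{s=1} L(E,s) = 1`, `2` inert in `K`, `W`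
`ℚ`-isogenous to `243a1^{(d)}` or `243a1^{(−23d)}`, `d ∈ 𝒩`, `χ_d(−N) = 1` ⇒ `BSD(E,2)`. [folklore] -/
@[conjecture] def WAllCornerFTwoInertKrizLiTwoFortyThree : Prop :=
  ∀ (W : WeierstrassCurve ℚ) [W.IsElliptic] [W.IsGloballyMinimal],
    W.HasCM → W.analyticRank = 1 → CMInert W 2 → P2.IsIsogenousToKrizLiTwoFortyThreeTwist W → BSDp W 2

/-- **Inert slices OFF BOTH EXPLICIT FAMILIES (OPEN) — the residual of the p3 road (v2).** CM,
`ord_{s=1} L(E,s) = 1`, `2` inert in `K`, `W` NOT `ℚ`-isogenous to any explicit Shu–Zhai twist of `36a1`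
and NOT `ℚ`-isogenous to any Kriz–Li twist of `243a1` ⇒ `BSD(E,2)`. Contains every cube-sum curve off the
class of `x³ + y³ = 9` (𝒞_HSY = K7t `X12.CMAtTwo` included) and the five odd Heegner fields; nothing in
print. [folklore] -/
@[conjecture] def WAllCornerFTwoInertOffShuZhaiOffKrizLi : Prop :=
  ∀ (W : WeierstrassCurve ℚ) [W.IsElliptic] [W.IsGloballyMinimal],
    W.HasCM → W.analyticRank = 1 → CMInert W 2 → ¬ P2.IsIsogenousToShuZhaiThirtySixTwist W →
      ¬ P2.IsIsogenousToKrizLiTwoFortyThreeTwist W → BSDp W 2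

/-! ### §2. Glue (excluded middle on the two memberships; good/bad at `2`) -/

/-- **The two inert slices ⟺ ON Shu–Zhai ∧ ON Kriz–Li ∧ OFF both** (EXACT; pure logic). [folklore] -/
theorem wAllCornerFTwoInert_iff_shuZhai_krizLi_off :
    (WAllCornerFTwoInertGood ∧ WAllCornerFTwoInertBad) ↔
      WAllCornerFTwoInertShuZhaiThirtySix ∧ WAllCornerFTwoInertKrizLiTwoFortyThree ∧
        WAllCornerFTwoInertOffShuZhaiOffKrizLi := by
  constructor
  · rintro ⟨hG, hB⟩
    refine ⟨fun W _ _ hcm hr1 hin _ ↦ ?_, fun W _ _ hcm hr1 hin _ ↦ ?_, fun W _ _ hcm hr1 hin _ _ ↦ ?_⟩ <;>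
    · by_cases hg : Good W 2
      · exact hG W hcm hr1 hin hg
      · exact hB W hcm hr1 hin hg
  · rintro ⟨hS, hK, hO⟩
    refine ⟨fun W _ _ hcm hr1 hin _ ↦ ?_, fun W _ _ hcm hr1 hin _ ↦ ?_⟩ <;>
    · by_cases h1 : P2.IsIsogenousToShuZhaiThirtySixTwist W
      · exact hS W hcm hr1 hin h1
      · by_cases h2 : P2.IsIsogenousToKrizLiTwoFortyThreeTwist W
        · exact hK W hcm hr1 hin h2
        · exact hO W hcm hr1 hin h1 h2

/-- **The first residual splits**: `WAllCornerFTwoInertOffShuZhaiThirtySix ⟺ (ON Kriz–Li, off Shu–Zhai)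
∧ OFF both`; stated as the two useful implications. The former residual implies the new one. [folklore] -/
theorem wAllCornerFTwoInertOffShuZhaiOffKrizLi_of_offShuZhai (h : WAllCornerFTwoInertOffShuZhaiThirtySix) :
    WAllCornerFTwoInertOffShuZhaiOffKrizLi :=
  fun W _ _ hcm hr1 hin h1 _ ↦ h W hcm hr1 hin h1

/-- … and the new ON-leaf with the new residual give back the former residual. [folklore] -/
theorem wAllCornerFTwoInertOffShuZhai_of_krizLi_of_off (hK : WAllCornerFTwoInertKrizLiTwoFortyThree)
    (hO : WAllCornerFTwoInertOffShuZhaiOffKrizLi) : WAllCornerFTwoInertOffShuZhaiThirtySix := by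
  intro W _ _ hcm hr1 hin h1
  by_cases h2 : P2.IsIsogenousToKrizLiTwoFortyThreeTwist W
  · exact hK W hcm hr1 hin h2
  · exact hO W hcm hr1 hin h1 h2

/-- The ON-leaf is implied by the row-12₂ leaf (it is a slice of it). [folklore] -/
theorem wAllCornerFTwoInertKrizLiTwoFortyThree_of_wAllCornerFTwo (h : WAllCornerFTwo) :
    WAllCornerFTwoInertKrizLiTwoFortyThree :=
  fun W _ _ hcm hr1 _ _ ↦ h W hcm hr1

/-- The OFF-leaf (the residual) is implied by the row-12₂ leaf. [folklore] -/
theorem wAllCornerFTwoInertOffShuZhaiOffKrizLi_of_wAllCornerFTwo (h : WAllCornerFTwo) :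
    WAllCornerFTwoInertOffShuZhaiOffKrizLi :=
  fun W _ _ hcm hr1 _ _ _ ↦ h W hcm hr1

/-- **Row 12₂ ⟺ split-good ∧ split-bad ∧ ramified ∧ (inert ON Shu–Zhai) ∧ (inert ON Kriz–Li) ∧
(inert OFF both)** — p4's five-way cut with the two inert slices replaced by the present three-way cut
(EXACT). [folklore] -/
theorem wAllCornerFTwo_iff_slices_shuZhai_krizLi :
    WAllCornerFTwo ↔ WAllCornerFTwoSplitGood ∧ WAllCornerFTwoSplitBad ∧ WAllCornerFTwoRamified ∧
      WAllCornerFTwoInertShuZhaiThirtySix ∧ WAllCornerFTwoInertKrizLiTwoFortyThree ∧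
        WAllCornerFTwoInertOffShuZhaiOffKrizLi := by
  rw [wAllCornerFTwo_iff_slices]
  constructor
  · rintro ⟨hSG, hSB, hR, hIG, hIB⟩
    exact ⟨hSG, hSB, hR, wAllCornerFTwoInert_iff_shuZhai_krizLi_off.1 ⟨hIG, hIB⟩⟩
  · rintro ⟨hSG, hSB, hR, hSKO⟩
    exact ⟨hSG, hSB, hR, wAllCornerFTwoInert_iff_shuZhai_krizLi_off.2 hSKO⟩

/-- **The sub-lane target `P2.CMNonsplitRankOneAtTwo` ⟺ ramified ∧ (ON Shu–Zhai) ∧ (ON Kriz–Li) ∧ (OFF both).**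
[folklore] -/
theorem cmNonsplitRankOneAtTwo_iff_ramified_shuZhai_krizLi_off :
    P2.CMNonsplitRankOneAtTwo ↔
      WAllCornerFTwoRamified ∧ WAllCornerFTwoInertShuZhaiThirtySix ∧ WAllCornerFTwoInertKrizLiTwoFortyThree ∧
        WAllCornerFTwoInertOffShuZhaiOffKrizLi := by
  rw [cmNonsplitRankOneAtTwo_iff_nonsplitSlices]
  constructor
  · rintro ⟨hR, hIG, hIB⟩
    exact ⟨hR, wAllCornerFTwoInert_iff_shuZhai_krizLi_off.1 ⟨hIG, hIB⟩⟩
  · rintro ⟨hR, hSKO⟩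
    exact ⟨hR, wAllCornerFTwoInert_iff_shuZhai_krizLi_off.2 hSKO⟩

/-! ### §3. The new ON-leaf CLOSED granted the named facts (by name) -/

/-- **`WAllCornerFTwoInertKrizLiTwoFortyThree` holds granted, BY NAME: Kriz–Li 2019 Thm 5.1 (2) (`hKL`)
and Thm 4.3 (`h33`), the Table-1 row `243a1` (`htab`), Creutz–Miller 2012 Thm 1.1 (`hS31`), the CM
rank-zero row C8 (`hBF`, Burungale–Flach 2024), modularity (`hmod`), Gross–Zagier–Kolyvagin (`hGZK`) and
Cassels' isogeny invariance (`hCassels`)** — the p3 closer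
`P2.cornerFTwo_krizLiTwoFortyThree_isogenyClass_byName` read on the leaf. Beyond print: YES as an assembly,
NO as a method. [cite: KrizLi2019, Thm. 5.1 (2), Thm. 4.3, §6 Table 1 row 243a1 and Rem. 6.3]
[cite: CreutzMiller2012, Thm. 1.1] [cite: BurungaleFlach2024, Thm. 1.1 and Cor. 2] [cite: MilneADT2006, Thm. I.7.3]
[cite: Miller2011LMS, Def. 1.1] -/
theorem wAllCornerFTwoInertKrizLiTwoFortyThree_of_facts (hKL : thm112_bsdTwo_twist)
    (h33 : thm33_rank_twist) (htab : table1_row243a1)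
    (hS31 : bsdTriple_of_analyticRank_le_one_of_conductor_lt) (hBF : bsdTriple_of_hasCM_of_L_one_ne_zero)
    (hmod : hasEntireLFunction_rat) (hGZK : rank_eq_analyticRank_of_analyticRank_le_one)
    (hCassels : bsdRHS_eq_of_isIsogenous) : WAllCornerFTwoInertKrizLiTwoFortyThree :=
  fun W _ _ hcm hr1 hin hW ↦
    P2.cornerFTwo_krizLiTwoFortyThree_isogenyClass_byName hKL h33 htab hS31 hBF hmod hGZK hCassels W hcm hr1
      hin hW

/-- **After the facts of both families, the inert slices ARE the OFF-both leaf**: granted the seven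
Shu–Zhai-side and eight Kriz–Li-side named facts (eleven distinct), the two inert slices of row 12₂ hold
iff `WAllCornerFTwoInertOffShuZhaiOffKrizLi` holds. [folklore] -/
theorem wAllCornerFTwoInert_iff_offShuZhaiOffKrizLi_of_facts (hCassels : bsdRHS_eq_of_isIsogenous)
    (h12 : thm12_ranks_of_twists) (h14 : thm14_twoPartBSD_of_twists)
    (hBF : bsdTriple_of_hasCM_of_L_one_ne_zero) (hmod : hasEntireLFunction_rat)
    (hARS : AgasheRibetStein2006.cremona_abs_maninConstant_eq_one_of_level_le) (htab36 : table52_row36a1)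
    (hKL : thm112_bsdTwo_twist) (h33 : thm33_rank_twist) (htab243 : table1_row243a1)
    (hS31 : bsdTriple_of_analyticRank_le_one_of_conductor_lt)
    (hGZK : rank_eq_analyticRank_of_analyticRank_le_one) :
    (WAllCornerFTwoInertGood ∧ WAllCornerFTwoInertBad) ↔ WAllCornerFTwoInertOffShuZhaiOffKrizLi := by
  rw [wAllCornerFTwoInert_iff_shuZhai_krizLi_off]
  exact ⟨fun h ↦ h.2.2, fun h ↦
    ⟨wAllCornerFTwoInertShuZhaiThirtySix_of_facts hCassels h12 h14 hBF hmod hARS htab36,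
      wAllCornerFTwoInertKrizLiTwoFortyThree_of_facts hKL h33 htab243 hS31 hBF hmod hGZK hCassels, h⟩⟩

end Summit.BirchSwinnertonDyer

end
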